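import Literature.MathematicalPhysics.QuantumFieldTheory.PeriodicBoxFreeEnergyLimits
import Literature.MathematicalPhysics.QuantumFieldTheory.PeriodicBoxPartitionFunction
import Literature.MathematicalPhysics.QuantumFieldTheory.AbelianContourClusterExpansion
import Summits.QuantumFields.YangMills.Theses.ComplexCouplingChannel
import HarnessLib

/-!
# `ComplexStrongCouplingAnchor` (route `ComplexCouplingChannel` of `QuantumFields/YangMills`)

Proof of the support item stmt-QuantumFields-18843: the strong-coupling anchor of the
complex-coupling channel. For every compact group `G` (simplicity is not used) and every continuous
unitary matrix representation `r`, there are `ρ₀, c > 0` such that for `‖z‖ < ρ₀` the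
complex-coupling Wilson partition functions of the periodic boxes — the inline `Zc` of the route,
identified with `partZ` of the box plaquette system by `boxSystem_partZ_univ_eq_finTorus`
(`PeriodicBoxPartitionFunction`) — satisfy: every tube `L³ × t` is zero-free with
`‖Zc·e^{-t e_L(z)} - 1‖ ≤ C_L e^{-ct}` for a tube rate `e_L` (`exists_tube_rate`), and the symmetric
tori `P⁴` are zero-free with `|log ‖Zc‖ + P⁴ Re f| ≤ C P⁴ e^{-cP}` for one `f` holomorphic on the disc
(`exists_cube_free_energy`); `log ‖Zc‖ = Re log Zc` for the Kotecký–Preiss logarithm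
(`PlaqSystem.re_pertLogZ_eq_log_norm_partZ`). Constants: `ρ₀ = (e²·4M·(D+1)²)⁻¹`, `M = costBound r.ρ`,
`D = boxDeg 4`, `c = 1/4`, `C_L = K e^K` with `K = 48 e L³`, `C = 12 e`.

References: K. Osterwalder, E. Seiler, Ann. Phys. 110 (1978) 440, §3; E. Seiler, LNP 159 (1982) Ch. 3;
R. Kotecký, D. Preiss, Comm. Math. Phys. 103 (1986) 491.
-/

noncomputable section

namespace Summit.QuantumFields.YangMills.Theorems

open MeasureTheory Finset Filter Topology
open Literature.Probability.LatticeModels Literature.MathematicalPhysics.QuantumFieldTheory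

/-- `x e^{-x/4} ≤ 4`. [folklore] -/
theorem mul_exp_neg_quarter_le (x : ℝ) : x * Real.exp (-(1 / 4 * x)) ≤ 4 := by
  have h := Real.add_one_le_exp (1 / 4 * x)
  have hpos := Real.exp_pos (1 / 4 * x)
  have hmul : Real.exp (-(1 / 4 * x)) * Real.exp (1 / 4 * x) = 1 := by rw [← Real.exp_add]; simp
  have hnn := Real.exp_pos (-(1 / 4 * x))
  nlinarith [mul_le_mul_of_nonneg_left h hnn.le]

/-- The floor rate against the quarter rate: `e^{-⌊t/2⌋} ≤ e · e^{-t/4} · e^{-t/4}`. [folklore] -/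
theorem exp_neg_floor_half_le_quarter (t : ℕ) :
    Real.exp (-((t / 2 : ℕ) : ℝ)) ≤ Real.exp 1 * Real.exp (-(1 / 4 * (t : ℝ))) * Real.exp (-(1 / 4 * (t : ℝ))) := by
  rw [← Real.exp_add, ← Real.exp_add]
  apply Real.exp_le_exp.2
  have h : (t : ℝ) - 1 ≤ 2 * ((t / 2 : ℕ) : ℝ) := by
    have : t - 1 ≤ 2 * (t / 2) := by omega
    have h' : ((t - 1 : ℕ) : ℝ) ≤ ((2 * (t / 2) : ℕ) : ℝ) := by exact_mod_cast this
    rcases Nat.eq_zero_or_pos t with rfl | ht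
    · simp
    · rw [Nat.cast_sub ht, Nat.cast_mul] at h'
      simpa using h'
  linarith

/-- **`ComplexStrongCouplingAnchor` holds** (item stmt-QuantumFields-18843 of the route
`ComplexCouplingChannel`): the Osterwalder–Seiler / Seiler strong-coupling cluster expansion of the
Wilson lattice gauge theory at COMPLEX coupling `z`, `‖z‖ < ρ₀`, on the periodic boxes `L³ × t` and
`P⁴`. With the Kotecký–Preiss logarithm `log Z` of the box partition function (the tree's `pertLogZ`
of the box plaquette system, `PeriodicBoxPlaqSystem`, `PlaqSystemClusterExpansion`): zero-freeness;
the tube rate `e_L = lim_t log Z(L³×t)/t` with `‖log Z(L³×t) - t e_L‖ ≤ 12 L³ t e^{-⌊t/2⌋}`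
(`exists_tube_rate`), whence `‖Z e^{-t e_L} - 1‖ ≤ C_L e^{-t/4}`; the holomorphic free energy
`f = -lim_P log Z(P⁴)/P⁴` with `|log ‖Z(P⁴)‖ + P⁴ Re f| ≤ ‖log Z(P⁴) + P⁴ f‖ ≤ 12 e P⁴ e^{-P/4}`
(`exists_cube_free_energy`). Constants: `ρ₀ = (e² · 4M · (D+1)²)⁻¹` with `M = costBound r.ρ`,
`D = boxDeg 4`; `c = 1/4`. The hypothesis that `G` be compact simple is not needed. -/
theorem complexStrongCouplingAnchor_proof :
    Summit.QuantumFields.YangMills.Theses.ComplexCouplingChannel.ComplexStrongCouplingAnchor := by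
  intro G _ _ _ _ _ _ _hG r Zc
  -- constants
  have hM : 0 < costBound r.ρ := costBound_pos r.ρ
  set M : ℝ := costBound r.ρ with hMdef
  set ρ₀ : ℝ := (Real.exp 2 * (4 * M) * ((boxDeg 4 : ℝ) + 1) ^ 2)⁻¹ with hρ₀def
  have hden : 0 < Real.exp 2 * (4 * M) * ((boxDeg 4 : ℝ) + 1) ^ 2 := by positivity
  have hρ₀ : 0 < ρ₀ := inv_pos.2 hden
  have hρ2 : Real.exp 2 * (2 * M * ρ₀) * ((boxDeg 4 : ℝ) + 1) ^ 2 ≤ 1 / 2 := by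
    rw [hρ₀def]; field_simp; norm_num
  have hρM : ρ₀ * M ≤ 1 := by
    have h1 : (1 : ℝ) ≤ Real.exp 2 := Real.one_le_exp (by norm_num)
    have h2 : (1 : ℝ) ≤ ((boxDeg 4 : ℝ) + 1) ^ 2 := one_le_pow₀ (by simp)
    rw [hρ₀def, inv_mul_le_iff₀ hden]
    nlinarith [mul_le_mul h1 h2 zero_le_one (by positivity)]
  have hρ2' : Real.exp 2 * (2 * costBound r.ρ * ρ₀) * ((boxDeg 4 : ℝ) + 1) ^ 2 ≤ 1 / 2 := hρ2
  -- the dictionary with the box system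
  have hZc : ∀ (z : ℂ) (a t : ℕ), Zc z a t =
      (boxSystem (G := G) r.ρ (![a, a, a, t] : Fin 4 → ℕ)).partZ Finset.univ z :=
    fun z a t => (boxSystem_partZ_univ_eq_finTorus r.ρ r.continuous a a a t z).symm
  -- the hypotheses of the cluster expansion at `‖z‖ < ρ₀`
  have hdisc : ∀ z : ℂ, ‖z‖ < ρ₀ → ‖z‖ * costBound r.ρ ≤ 1 ∧
      Real.exp 1 * (2 * costBound r.ρ * ‖z‖) * ((boxDeg 4 : ℝ) + 1) ^ 2 ≤ 1 / 2 := by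
    intro z hz
    have h := disc_hypotheses (D := boxDeg 4) hM (r := ρ₀) hρM hρ2 hz.le
    exact ⟨h.1, h.2.2⟩
  refine ⟨ρ₀, hρ₀, 1 / 4, by norm_num, fun L hL => ?_, ?_⟩
  · -- tubes
    obtain ⟨e, he⟩ := exists_tube_rate (G := G) r.continuous hρM hρ2' (a := L) hL
    set K : ℝ := 48 * Real.exp 1 * (L : ℝ) ^ 3 with hK
    have hK0 : 0 ≤ K := by positivity
    refine ⟨K * Real.exp K, e, fun t ht z hz => ?_⟩
    obtain ⟨hzM, hz1⟩ := hdisc z hz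
    have hR := boxSystem_regular (d := 4) (G := G) r.ρ r.continuous (![L, L, L, t] : Fin 4 → ℕ)
    have hexp := PlaqSystem.exp_pertLogZ_eq_partZ hR hzM hz1 Finset.univ
    refine ⟨?_, ?_⟩
    · rw [hZc]; exact PlaqSystem.partZ_ne_zero_of_small hR hzM hz1 Finset.univ
    · set h : ℂ := pertLogZ (zdHaar 4 G) ((boxSystem (G := G) r.ρ (![L, L, L, t] : Fin 4 → ℕ)).weight z)
          (boxSystem (G := G) r.ρ (![L, L, L, t] : Fin 4 → ℕ)).Adj Finset.univ - (t : ℂ) * e z with hh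
      have hbound : ‖h‖ ≤ K * Real.exp (-(1 / 4 * (t : ℝ))) := by
        have h1 := he t ht z hz.le
        rw [← hh] at h1
        refine h1.trans ?_
        have ht0 : (0 : ℝ) ≤ t := Nat.cast_nonneg t
        calc 12 * (L : ℝ) ^ 3 * t * Real.exp (-((t / 2 : ℕ) : ℝ))
            ≤ 12 * (L : ℝ) ^ 3 * t * (Real.exp 1 * Real.exp (-(1 / 4 * (t : ℝ))) * Real.exp (-(1 / 4 * (t : ℝ)))) :=
              mul_le_mul_of_nonneg_left (exp_neg_floor_half_le_quarter t) (by positivity)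
          _ = 12 * Real.exp 1 * (L : ℝ) ^ 3 * ((t : ℝ) * Real.exp (-(1 / 4 * (t : ℝ)))) * Real.exp (-(1 / 4 * (t : ℝ))) := by
              ring
          _ ≤ 12 * Real.exp 1 * (L : ℝ) ^ 3 * 4 * Real.exp (-(1 / 4 * (t : ℝ))) := by
              gcongr
              exact mul_exp_neg_quarter_le (t : ℝ)
          _ = K * Real.exp (-(1 / 4 * (t : ℝ))) := by rw [hK]; ring
      have hle1 : Real.exp (-(1 / 4 * (t : ℝ))) ≤ 1 := Real.exp_le_one_iff.2 (by
        have : (0 : ℝ) ≤ t := Nat.cast_nonneg t; nlinarith)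
      have hK' : ‖h‖ ≤ K := hbound.trans (by nlinarith)
      have heq : Zc z L t * Complex.exp (-((t : ℂ) * e z)) - 1 = Complex.exp h - 1 := by
        rw [hh, hZc, ← hexp, ← Complex.exp_add, ← sub_eq_add_neg]
      rw [heq]
      calc ‖Complex.exp h - 1‖ ≤ ‖h‖ * Real.exp ‖h‖ := LatticeForm.norm_exp_sub_one_le_mul_exp h
        _ ≤ (K * Real.exp (-(1 / 4 * (t : ℝ)))) * Real.exp K :=
            mul_le_mul hbound (Real.exp_le_exp.2 hK') (Real.exp_pos _).le (by positivity)
        _ = K * Real.exp K * Real.exp (-(1 / 4 * (t : ℝ))) := by ring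
  · -- tori
    obtain ⟨f, hf, hfb⟩ := exists_cube_free_energy (G := G) r.continuous hρ₀.le hρM hρ2'
    refine ⟨f, hf, 12 * Real.exp 1, fun P hP z hz => ?_⟩
    obtain ⟨hzM, hz1⟩ := hdisc z hz
    have hR := boxSystem_regular (d := 4) (G := G) r.ρ r.continuous (![P, P, P, P] : Fin 4 → ℕ)
    refine ⟨?_, ?_⟩
    · rw [hZc]; exact PlaqSystem.partZ_ne_zero_of_small hR hzM hz1 Finset.univ
    · set LZ : ℂ := pertLogZ (zdHaar 4 G) ((boxSystem (G := G) r.ρ (![P, P, P, P] : Fin 4 → ℕ)).weight z)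
          (boxSystem (G := G) r.ρ (![P, P, P, P] : Fin 4 → ℕ)).Adj Finset.univ with hLZ
      have hlog : Real.log ‖Zc z P P‖ = LZ.re := by
        rw [hZc, ← PlaqSystem.re_pertLogZ_eq_log_norm_partZ hR hzM hz1 Finset.univ]
      have hre : Real.log ‖Zc z P P‖ + (P : ℝ) ^ 4 * (f z).re = (LZ + (P : ℂ) ^ 4 * f z).re := by
        rw [hlog, Complex.add_re]
        congr 1
        have : ((P : ℂ) ^ 4) = (((P : ℝ) ^ 4 : ℝ) : ℂ) := by push_cast; ring
        rw [this, Complex.re_ofReal_mul]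
      rw [hre]
      refine (Complex.abs_re_le_norm _).trans ((hfb P hP z hz.le).trans ?_)
      have hP0 : (0 : ℝ) ≤ P := Nat.cast_nonneg P
      have hle : Real.exp (-(1 / 4 * (P : ℝ))) ≤ 1 := Real.exp_le_one_iff.2 (by nlinarith)
      calc 12 * (P : ℝ) ^ 4 * Real.exp (-((P / 2 : ℕ) : ℝ))
          ≤ 12 * (P : ℝ) ^ 4 * (Real.exp 1 * Real.exp (-(1 / 4 * (P : ℝ))) * Real.exp (-(1 / 4 * (P : ℝ)))) :=
            mul_le_mul_of_nonneg_left (exp_neg_floor_half_le_quarter P) (by positivity)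
        _ ≤ 12 * (P : ℝ) ^ 4 * (Real.exp 1 * Real.exp (-(1 / 4 * (P : ℝ))) * 1) := by gcongr
        _ = 12 * Real.exp 1 * (P : ℝ) ^ 4 * Real.exp (-(1 / 4 * (P : ℝ))) := by ring

end Summit.QuantumFields.YangMills.Theorems
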